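import Summits.KontsevichZagierPeriods.KontsevichZagierPeriods.Theorems.SoloBlindFermatCubic
import Summits.KontsevichZagierPeriods.KontsevichZagierPeriods.Theorems.SoloBlindBoxRankOne
import HarnessLib

/-!
# Regulator regions: `area {0<x<1, 0≤y, y²(x²+q) ≤ 1} = log ((1+√(1+q))/√q)` inside the rules

For every rational `q > 0` the `ℚ`-rational planar region

  `G_q = {(x,y) | 0 < x < 1, 0 ≤ y, y²(x² + q) ≤ 1}`,  `area(G_q) = ∫₀¹ dx/√(x²+q) = arsinh (1/√q)`,

is carried by KZ moves to the logarithmic cell `L(1; ε_q)`, `ε_q = (1+√(1+q))/√q`: Newton–Leibniz,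
the RATIONAL chart `x = (u² - q)/(2u)` (Euler's substitution: `dx/√(x²+q) = du/u`), removal of the
two endpoints, the dilation `u ↦ u/√q`.  Hence **`[G_q] = ℓ(ε_q)`** (`mkQ_hypReg`), `G_q ∈ V`, the
Kontsevich–Zagier conjecture holds for `G_q` against every class of the cell span (`kz_hypReg`,
Baker), and `area(G_q) = log ε_q` is READ OFF (`hypReg_value`).  For `q = m²`, `ε_q` is a unit of
norm `-1` of `ℚ(√(1+m²))`: `q = 4` gives **`area(G_4) = log φ`**, the golden ratio
(`golden_value`, `[G_4] = ℓ(φ)`); `q = 1` the silver ratio (cf. `SoloBlindSilver`).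

References: Kontsevich–Zagier, *Periods* (2001), §1.1–1.2; Baker (1975), Ch. 2. -/

noncomputable section

namespace Summit.KontsevichZagierPeriods.KontsevichZagierPeriods.Theorems

open Set MeasureTheory
open Literature.ModelTheory.ExponentialFields (IsSemialgebraic)
open MvPolynomial (aeval X C)
open Literature.NumberTheory.Transcendental
open Literature.NumberTheory.Transcendental.KZ

namespace SoloBlind

variable (q : ℚ)

/-! ## The endpoints `√q < 1 + √(1+q)` and the unit `ε_q` -/

/-- `lo_q = √q`. -/
def lo : ℝ := Real.sqrt q

/-- `hi_q = 1 + √(1+q)`. -/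
def hi : ℝ := 1 + Real.sqrt (1 + q)

/-- `ε_q = (1+√(1+q))/√q`. -/
def eps : ℝ := hi q / lo q

/-- `0 < lo_q`. -/
theorem lo_pos (hq : 0 < q) : 0 < lo q := Real.sqrt_pos.mpr (by exact_mod_cast hq)

/-- `lo_q < hi_q`. -/
theorem lo_lt_hi : lo q < hi q := by
  have h : Real.sqrt q ≤ Real.sqrt (1 + q) := Real.sqrt_le_sqrt (by linarith)
  unfold lo hi
  linarith

/-- `1 < ε_q`. -/
theorem one_lt_eps (hq : 0 < q) : 1 < eps q := (one_lt_div (lo_pos q hq)).mpr (lo_lt_hi q)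

/-- `lo_q² = q` (`0 ≤ q`). -/
theorem lo_sq (h : (0:ℚ) ≤ q) : lo q ^ 2 = q := Real.sq_sqrt (by exact_mod_cast h)

/-- `(hi_q - 1)² = 1 + q` (`0 ≤ q`). -/
theorem hi_sub_one_sq (h : (0:ℚ) ≤ q) : (hi q - 1) ^ 2 = 1 + q := by
  rw [hi, add_sub_cancel_left, Real.sq_sqrt (by exact_mod_cast (by linarith : (0:ℚ) ≤ 1 + q))]

/-- `lo_q` is algebraic. -/
theorem isAlgebraic_lo (h : (0:ℚ) ≤ q) : IsAlgebraic ℚ (lo q) :=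
  ⟨Polynomial.X ^ 2 - Polynomial.C q, Polynomial.X_pow_sub_C_ne_zero two_pos q, by
    simp [lo_sq q h]⟩

/-- `hi_q` is algebraic. -/
theorem isAlgebraic_hi (h : (0:ℚ) ≤ q) : IsAlgebraic ℚ (hi q) := by
  have h1 := isAlgebraic_lo (1 + q) (by linarith)
  rw [lo, Rat.cast_add, Rat.cast_one] at h1
  exact isAlgebraic_one.add h1

/-- `ε_q` is algebraic. -/
theorem isAlgebraic_eps (h : (0:ℚ) ≤ q) : IsAlgebraic ℚ (eps q) :=
  (isAlgebraic_hi q h).mul (isAlgebraic_lo q h).inv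

/-- `h_q(x) = (x² + q)^{-1/2}`. -/
def hypR (x : ℝ) : ℝ := (x ^ 2 + q) ^ ((((-1:ℚ) / 2 : ℚ) : ℝ))

/-- `h_q(x) = 1/√(x²+q)`. -/
theorem hypR_eq (hq : 0 < q) (x : ℝ) : hypR q x = 1 / Real.sqrt (x ^ 2 + q) := by
  have h0 : (0:ℝ) ≤ x ^ 2 + q := by positivity
  rw [hypR, Real.sqrt_eq_rpow, one_div, ← Real.rpow_neg h0]
  norm_num

/-- `0 < h_q(x)`. -/
theorem hypR_pos (hq : 0 < q) (x : ℝ) : 0 < hypR q x := Real.rpow_pos_of_pos (by positivity) _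

/-- `h_q` is continuous. -/
theorem continuous_hypR (hq : 0 < q) : Continuous (hypR q) :=
  ((continuous_pow 2).add continuous_const).rpow_const fun x =>
    Or.inl (by positivity : (0:ℝ) < x ^ 2 + q).ne'

/-- `h_q` is integrable on `(0,1)`. -/
theorem integrableOn_hypR (hq : 0 < q) : IntegrableOn (hypR q) (Ioo 0 1) :=
  (continuous_hypR q hq).continuousOn.integrableOn_Icc.mono_set Ioo_subset_Icc_self

/-- `h_q` is `ℚ`-semialgebraic on `(0,1)` (an Euler–Mellin integrand). -/
theorem isSemialgebraicFunOn_hypR (hq : 0 < q) :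
    IsSemialgebraicFunOn ℚ (line (Ioo 0 1)) (fun x : Fin 1 → ℝ => hypR q (x 0)) := by
  have h := isSemialgebraicFunOn_mellinIntegrand
    (isSemialgebraic_line_Ioo isAlgebraic_zero isAlgebraic_one)
    ![(X 0 ^ 2 + C q : MvPolynomial (Fin 1) ℚ)] ![((-1:ℚ) / 2 : ℚ)] 1 (fun x _ k => by
      have hx : (0:ℝ) < x 0 ^ 2 + q := by positivity
      simpa using hx)
  refine h.congr fun x _ => ?_
  simp only [mellinIntegrand_apply, Fin.prod_univ_one, Matrix.cons_val_fin_one, map_add, map_pow,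
    MvPolynomial.aeval_X, MvPolynomial.aeval_C, eq_ratCast, hypR]
  push_cast
  ring_nf

/-- **`[(0,1), (x²+q)^{-1/2}]`.** -/
def hypR1 (hq : 0 < q) : IntegralRep 1 :=
  lineRep (Ioo 0 1) (hypR q) (isSemialgebraic_line_Ioo isAlgebraic_zero isAlgebraic_one)
    (isSemialgebraicFunOn_hypR q hq) (integrableOn_hypR q hq)

/-- `G_q = {0 < x < 1, 0 ≤ y, y²(x²+q) ≤ 1}`. -/
def kzReg : Set (Fin 2 → ℝ) :=
  {z | (0 < z 0 ∧ z 0 < 1) ∧ 0 ≤ z 1 ∧ z 1 ^ 2 * (z 0 ^ 2 + q) ≤ 1}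

/-- `kzReg q` is `ℚ`-semialgebraic. -/
theorem isSemialgebraic_kzReg : IsSemialgebraic ℚ (kzReg q) := by
  convert isSemialgebraic_subgraph (X 1 ^ 2 * (X 0 ^ 2 + C q)) 1 using 1
  ext z
  simp [kzReg]

/-- `kzReg q` is the region under the graph of `h_q`. -/
theorem kzReg_eq (hq : 0 < q) :
    kzReg q = {z | (0 < z 0 ∧ z 0 < 1) ∧ 0 ≤ z 1 ∧ z 1 ≤ hypR q (z 0)} := by
  ext z
  simp only [kzReg, mem_setOf_eq]
  refine and_congr_right fun _ => and_congr_right fun hy => ?_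
  have h0 : (0:ℝ) < z 0 ^ 2 + q := by positivity
  rw [hypR_eq q hq, one_div, ← Real.sqrt_inv, Real.le_sqrt hy, ← one_div, le_div_iff₀ h0]
  exact inv_nonneg.mpr h0.le

/-- `kzReg q` lies in the box `[0, (1+q)/q]²`. -/
theorem kzReg_subset (hq : 0 < q) : kzReg q ⊆ Icc (0 : Fin 2 → ℝ) (fun _ => (1 + q) / q) := by
  intro z hz
  obtain ⟨hx, hy, h⟩ := hz
  have hq' : (0:ℝ) < q := by exact_mod_cast hq
  have hyq : z 1 ^ 2 * q ≤ 1 := by nlinarith [mul_nonneg (sq_nonneg (z 1)) (sq_nonneg (z 0))]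
  have hy1 : z 1 ≤ (1 + q) / q := by
    rw [le_div_iff₀ hq']
    nlinarith [sq_nonneg (z 1 * q - 1), mul_le_mul_of_nonneg_right hyq hq'.le]
  have hx1 : z 0 ≤ (1 + q) / q := by
    rw [le_div_iff₀ hq']
    nlinarith [mul_lt_mul_of_pos_right hx.2 hq']
  simp only [mem_Icc, Pi.le_def, Pi.zero_apply, Fin.forall_fin_two]
  exact ⟨⟨hx.1.le, hy⟩, hx1, hy1⟩

/-- `1` is integrable on `kzReg q`. -/
theorem integrableOn_one_kzReg (hq : 0 < q) : IntegrableOn (fun _ : Fin 2 → ℝ => (1:ℝ)) (kzReg q) :=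
  integrableOn_const ((measure_mono (kzReg_subset q hq)).trans_lt measure_Icc_lt_top).ne

/-- **`G_q = [{0<x<1, 0≤y, y²(x²+q)≤1}, 1]`**, with `ℚ`-rational data. -/
def hypReg (hq : 0 < q) : IntegralRep 2 :=
  ratRep (kzReg q) (fun _ => 1) 1 1 (isSemialgebraic_kzReg q) (fun _ _ => by simp)
    (fun _ _ => by simp) (integrableOn_one_kzReg q hq)

/-- `G_q` has KZ's literal rational shape. -/
theorem isRational_hypReg (hq : 0 < q) : (hypReg q hq).IsRational := isRational_ratRep

/-- **Move (Newton–Leibniz): `G_q ≡ [(0,1), h_q]`.** -/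
theorem hypReg_sub_hypR1 (hq : 0 < q) : of (hypReg q hq) - of (hypR1 q hq) ∈ relations :=
  subgraph_sub_lineRep (hypReg q hq) (fun x _ => (hypR_pos q hq x).le) (kzReg_eq q hq) rfl

/-- `φ_q(u) = (u² - q)/(2u)`. -/
def eulerChart (u : ℝ) : ℝ := (u ^ 2 - q) / (2 * u)

/-- Its derivative, in quotient-rule form. -/
def eulerChart' (u : ℝ) : ℝ := (2 * u * (2 * u) - (u ^ 2 - q) * 2) / (2 * u) ^ 2

/-- `|φ_q'(u)| = (u²+q)/(2u²)` (`u > 0`, `q > 0`). -/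
theorem abs_eulerChart' {u : ℝ} (hu : 0 < u) (h : (0:ℚ) ≤ q) :
    |eulerChart' q u| = (u ^ 2 + q) / (2 * u ^ 2) := by
  have hq' : (0:ℝ) ≤ q := by exact_mod_cast h
  rw [eulerChart', abs_of_nonneg (by apply div_nonneg <;> nlinarith)]
  field_simp
  ring

/-- The quotient rule for `φ_q`. -/
theorem hasDerivAt_eulerChart {u : ℝ} (hu : 0 < u) :
    HasDerivAt (eulerChart q) (eulerChart' q u) u := by
  have h1 : HasDerivAt (fun y : ℝ => y ^ 2 - q) (2 * u) u := by
    simpa using (hasDerivAt_pow 2 u).sub_const (q:ℝ)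
  have h2 : HasDerivAt (fun y : ℝ => 2 * y) 2 u := by
    simpa using (hasDerivAt_id u).const_mul 2
  exact h1.div h2 (by positivity)

/-- `φ_q` is `ℚ`-semialgebraic on `(lo_q, hi_q)` (a rational function over `ℚ`). -/
theorem isSemialgebraicFunOn_eulerChart (hq : 0 < q) :
    IsSemialgebraicFunOn ℚ (line (Ioo (lo q) (hi q)))
      (fun x : Fin 1 → ℝ => eulerChart q (x 0)) := by
  have hS := isSemialgebraic_line_Ioo (isAlgebraic_lo q hq.le) (isAlgebraic_hi q hq.le)
  refine (isSemialgebraicFunOn_aeval_div_aeval hS (X 0 ^ 2 - C q) (2 * X 0) fun x hx => ?_).congr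
    fun x _ => ?_
  · have hx : 0 < x 0 := (lo_pos q hq).trans hx.1
    have h : aeval x (2 * X 0 : MvPolynomial (Fin 1) ℚ) = 2 * x 0 := by simp
    rw [h]
    positivity
  · simp [eulerChart]

/-- `φ_q` is strictly increasing on `(0, ∞)`. -/
theorem strictMonoOn_eulerChart (hq : 0 < q) : StrictMonoOn (eulerChart q) (Ioi 0) := by
  intro s hs t ht hst
  have hs0 : (0:ℝ) < s := hs
  have ht0 : (0:ℝ) < t := ht
  have hq' : (0:ℝ) < q := by exact_mod_cast hq
  unfold eulerChart
  rw [div_lt_div_iff₀ (by positivity) (by positivity)]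
  nlinarith [mul_pos (mul_pos hs0 ht0) (sub_pos.mpr hst), mul_pos hq' (sub_pos.mpr hst)]

/-- `φ_q(lo_q) = 0`. -/
theorem eulerChart_lo (h : (0:ℚ) ≤ q) : eulerChart q (lo q) = 0 := by
  simp [eulerChart, lo_sq q h]

/-- `φ_q(hi_q) = 1`. -/
theorem eulerChart_hi (hq : 0 < q) : eulerChart q (hi q) = 1 := by
  have h0 : 0 < hi q := (lo_pos q hq).trans (lo_lt_hi q)
  have h := hi_sub_one_sq q hq.le
  rw [eulerChart, div_eq_one_iff_eq (by positivity)]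
  nlinarith [h]

/-- The inverse chart `u = x + √(x²+q)` lands in `(lo_q, hi_q)` for `x ∈ (0,1)`. -/
theorem invChartR_mem (hq : 0 < q) {x : ℝ} (hx : x ∈ Ioo (0:ℝ) 1) :
    x + Real.sqrt (x ^ 2 + q) ∈ Ioo (lo q) (hi q) := by
  have hq' : (0:ℝ) ≤ q := by exact_mod_cast hq.le
  have h1 : Real.sqrt q ≤ Real.sqrt (x ^ 2 + q) := Real.sqrt_le_sqrt (by nlinarith)
  have h2 : Real.sqrt (x ^ 2 + q) < Real.sqrt (1 + q) :=
    Real.sqrt_lt_sqrt (by positivity) (by nlinarith [hx.1, hx.2])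
  constructor
  · unfold lo
    linarith [hx.1]
  · unfold hi
    linarith [hx.2]

/-- `φ_q(x + √(x²+q)) = x`. -/
theorem eulerChart_invChart (hq : 0 < q) {x : ℝ} (hx : 0 < x) :
    eulerChart q (x + Real.sqrt (x ^ 2 + q)) = x := by
  have hq' : (0:ℝ) ≤ q := by exact_mod_cast hq.le
  have hs := Real.sq_sqrt (by positivity : (0:ℝ) ≤ x ^ 2 + q)
  have hpos : 0 < x + Real.sqrt (x ^ 2 + q) := by positivity
  rw [eulerChart, div_eq_iff (by positivity)]
  nlinarith [hs]

/-- `φ_q` maps `(lo_q, hi_q)` onto `(0, 1)`. -/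
theorem image_eulerChart (hq : 0 < q) : Ioo (0:ℝ) 1 = eulerChart q '' Ioo (lo q) (hi q) := by
  ext x
  constructor
  · intro hx
    exact ⟨_, invChartR_mem q hq hx, eulerChart_invChart q hq hx.1⟩
  · rintro ⟨u, hu, rfl⟩
    have hm := strictMonoOn_eulerChart q hq
    have hl0 : lo q ∈ Ioi (0:ℝ) := mem_Ioi.mpr (lo_pos q hq)
    have hu0 : u ∈ Ioi (0:ℝ) := mem_Ioi.mpr ((lo_pos q hq).trans hu.1)
    refine ⟨?_, ?_⟩
    · rw [← eulerChart_lo q hq.le]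
      exact hm hl0 hu0 hu.1
    · rw [← eulerChart_hi q hq]
      exact hm hu0 (mem_Ioi.mpr ((lo_pos q hq).trans (lo_lt_hi q))) hu.2

/-- **Euler's substitution**: `h_q(φ_q(u))·|φ_q'(u)| = 1/u`. -/
theorem eulerChart_pullback (hq : 0 < q) {u : ℝ} (hu : 0 < u) :
    1 / u = hypR q (eulerChart q u) * |eulerChart' q u| := by
  have hq' : (0:ℝ) < q := by exact_mod_cast hq
  have hsq : eulerChart q u ^ 2 + q = ((u ^ 2 + q) / (2 * u)) ^ 2 := by
    unfold eulerChart
    field_simp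
    ring
  rw [abs_eulerChart' q hu hq.le, hypR_eq q hq, hsq, Real.sqrt_sq (by positivity)]
  field_simp

/-- The semialgebraic data of the interval `(lo_q, hi_q)` resp. its two endpoints. -/
theorem isSemialgebraic_ends (h : (0:ℚ) ≤ q) :
    IsSemialgebraic ℚ (line (Icc (lo q) (lo q) ∪ Icc (hi q) (hi q))) :=
  (isSemialgebraic_line_Icc (isAlgebraic_lo q h) (isAlgebraic_lo q h)).union
    (isSemialgebraic_line_Icc (isAlgebraic_hi q h) (isAlgebraic_hi q h))

/-- `x ↦ 1/x₀` is `ℚ`-semialgebraic on the line over any semialgebraic `S ⊆ [lo_q, ∞)`. -/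
theorem isSemialgebraicFunOn_inv_of (hq : 0 < q) {S : Set ℝ} (hS : IsSemialgebraic ℚ (line S))
    (h0 : ∀ t ∈ S, lo q ≤ t) : IsSemialgebraicFunOn ℚ (line S) (fun x : Fin 1 → ℝ => 1 / x 0) :=
  (isSemialgebraicFunOn_const_of_isAlgebraic hS isAlgebraic_one).div
    (isSemialgebraicFunOn_apply hS 0) fun _ hx => ((lo_pos q hq).trans_le (h0 _ hx)).ne'

/-- **`[(lo_q, hi_q), du/u]`.** -/
def openLogR (hq : 0 < q) : IntegralRep 1 :=
  lineRep (Ioo (lo q) (hi q)) (fun t => 1 / t)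
    (isSemialgebraic_line_Ioo (isAlgebraic_lo q hq.le) (isAlgebraic_hi q hq.le))
    (isSemialgebraicFunOn_inv_of q hq
      (isSemialgebraic_line_Ioo (isAlgebraic_lo q hq.le) (isAlgebraic_hi q hq.le))
      fun _ ht => ht.1.le)
    ((integrableOn_log_integrand 1 (lo_pos q hq)).mono_set Ioo_subset_Icc_self)

/-- **Move (Euler's substitution): `[(lo_q, hi_q), du/u] ≡ [(0,1), h_q]`.** -/
theorem openLogR_sub_hypR1 (hq : 0 < q) : of (openLogR q hq) - of (hypR1 q hq) ∈ relations := by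
  unfold openLogR hypR1
  exact lineRep_subst (eulerChart q) (eulerChart' q) (isSemialgebraicFunOn_eulerChart q hq)
    (fun t ht => (hasDerivAt_eulerChart q ((lo_pos q hq).trans ht.1)).hasDerivWithinAt)
    ((strictMonoOn_eulerChart q hq).mono fun _ hu => (lo_pos q hq).trans hu.1).injOn
    (image_eulerChart q hq) (fun t ht => eulerChart_pullback q hq ((lo_pos q hq).trans ht.1))

/-- The two endpoints as a (null) domain with the same integrand. -/
def endsR (hq : 0 < q) : IntegralRep 1 :=
  lineRep (Icc (lo q) (lo q) ∪ Icc (hi q) (hi q)) (fun t => 1 / t) (isSemialgebraic_ends q hq.le)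
    (isSemialgebraicFunOn_inv_of q hq (isSemialgebraic_ends q hq.le) fun t ht => by
      rcases ht with ht | ht
      · exact ht.1
      · exact (lo_lt_hi q).le.trans ht.1)
    ((integrableOn_log_integrand 1 (lo_pos q hq)).mono_set (union_subset
      (Icc_subset_Icc le_rfl (lo_lt_hi q).le) (Icc_subset_Icc (lo_lt_hi q).le le_rfl)))

/-- `L(1; lo_q, hi_q) = [[lo_q, hi_q], du/u]`. -/
def segR (hq : 0 < q) : IntegralRep 1 :=
  logSeg 1 (lo q) (hi q) isAlgebraic_one (isAlgebraic_lo q hq.le) (isAlgebraic_hi q hq.le)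
    (lo_pos q hq)

/-- `[lo, hi] = (lo, hi) ∪ {lo, hi}`. -/
theorem Icc_lo_hi : Icc (lo q) (hi q) =
    Ioo (lo q) (hi q) ∪ (Icc (lo q) (lo q) ∪ Icc (hi q) (hi q)) := by
  rw [Icc_self, Icc_self, ← union_assoc, Ioo_union_left (lo_lt_hi q),
    Ico_union_right (lo_lt_hi q).le]

/-- **Moves (domain additivity, null endpoints): `L(1; lo_q, hi_q) ≡ [(lo_q, hi_q), du/u]`.** -/
theorem segR_sub_openLogR (hq : 0 < q) : of (segR q hq) - of (openLogR q hq) ∈ relations := by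
  have hnull : volume (line (Icc (lo q) (lo q) ∪ Icc (hi q) (hi q))) = 0 := by
    rw [volume_line, Icc_self, Icc_self]
    exact ((Set.finite_singleton _).union (Set.finite_singleton _)).measure_zero _
  have h : of (segR q hq) - of (openLogR q hq) - of (endsR q hq) ∈ relations := by
    refine domainAddRel_subset_relations ⟨1, segR q hq, openLogR q hq, endsR q hq,
      ?_, ?_, fun _ _ => rfl, fun _ _ => rfl, rfl⟩
    · simp only [segR, logSeg_domain, openLogR, endsR, lineRep_domain, ← line_union, ← Icc_lo_hi]
    · simp only [openLogR, endsR, lineRep_domain]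
      exact measure_mono_null inter_subset_right hnull
  have he : of (endsR q hq) ∈ relations :=
    of_mem_relations_of_volume_eq_zero _ (by rw [endsR, lineRep_domain]; exact hnull)
  simpa [sub_add_cancel] using relations.add_mem h he

/-- **Move (dilation by `1/√q`): `L(1; lo_q, hi_q) ≡ L(1; ε_q)`.** -/
theorem segR_sub_logCell (hq : 0 < q) : of (segR q hq) -
    of (logCell 1 (eps q) isAlgebraic_one (isAlgebraic_eps q hq.le)) ∈ relations := by
  rw [segR, logCell_eq]
  exact logSeg_dilate (isAlgebraic_lo q hq.le).inv (inv_pos.mpr (lo_pos q hq))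
    (by rw [inv_mul_cancel₀ (lo_pos q hq).ne']) (by rw [eps, div_eq_inv_mul])

/-- **`[G_q] = ℓ(ε_q)`** in `Q`: Newton–Leibniz, Euler's substitution, endpoints, dilation. -/
theorem mkQ_hypReg (hq : 0 < q) : mkQ (of (hypReg q hq)) = ell (eps q) := by
  rw [ell_eq (isAlgebraic_eps q hq.le), mkQ_eq_mkQ_iff]
  have h := relations.add_mem (relations.sub_mem (relations.sub_mem (hypReg_sub_hypR1 q hq)
    (openLogR_sub_hypR1 q hq)) (segR_sub_openLogR q hq)) (segR_sub_logCell q hq)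
  convert h using 1
  abel

/-- `G_q` lies in the cell span `V`. -/
theorem mkQ_hypReg_mem_cellSpan (hq : 0 < q) : mkQ (of (hypReg q hq)) ∈ cellSpan := by
  rw [mkQ_hypReg]
  exact ell_mem_cellSpan (isAlgebraic_eps q hq.le) (one_lt_eps q hq)

/-- **`area(G_q) = log ((1+√(1+q))/√q)`** (`= arsinh (1/√q)`), read off from the moves. -/
theorem hypReg_value (hq : 0 < q) :
    (hypReg q hq).value = Real.log ((1 + Real.sqrt (1 + q)) / Real.sqrt q) := by
  have h := congrArg evalQ (mkQ_hypReg q hq)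
  rw [evalQ_mkQ, eval_of, evalQ_ell (isAlgebraic_eps q hq.le) (one_lt_eps q hq).le] at h
  simpa [eps, hi, lo] using h

/-- **The Kontsevich–Zagier conjecture for `G_q`**, unconditionally, against every
representation with class in `V` (Baker injectivity `eq_zero_of_mem_cellSpan`). -/
theorem kz_hypReg (hq : 0 < q) {m : ℕ} (r' : IntegralRep m) (hr' : mkQ (of r') ∈ cellSpan)
    (hv : (hypReg q hq).value = r'.value) : Equivalent (hypReg q hq) r' := by
  rw [Equivalent, ← mkQ_eq_mkQ_iff, ← sub_eq_zero]
  exact eq_zero_of_mem_cellSpan (sub_mem (mkQ_hypReg_mem_cellSpan q hq) hr')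
    (by rw [map_sub, evalQ_mkQ, evalQ_mkQ, eval_of, eval_of, hv, sub_self])

/-- `ε_4 = φ = (1+√5)/2`. -/
theorem eps_four : eps 4 = Real.goldenRatio := by
  have h4 : Real.sqrt ((4:ℚ):ℝ) = 2 := by
    rw [show ((4:ℚ):ℝ) = 2 ^ 2 by norm_num, Real.sqrt_sq zero_le_two]
  rw [eps, hi, lo, h4, Real.goldenRatio]
  norm_num

/-- **`[G_4] = ℓ(φ)`**: the class of `{0<x<1, 0≤y, y²(x²+4) ≤ 1}` is the golden logarithmic cell. -/
theorem mkQ_hypReg_four : mkQ (of (hypReg 4 four_pos)) = ell Real.goldenRatio := by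
  rw [mkQ_hypReg, eps_four]

/-- **`area {0<x<1, 0≤y, y²(x²+4) ≤ 1} = log φ`**, the logarithm of the golden ratio. -/
theorem golden_value : (hypReg 4 four_pos).value = Real.log Real.goldenRatio := by
  have h := congrArg evalQ mkQ_hypReg_four
  rwa [evalQ_mkQ, eval_of, ← eps_four, evalQ_ell (isAlgebraic_eps 4 (by norm_num))
    (one_lt_eps 4 four_pos).le, eps_four] at h

end SoloBlind

end Summit.KontsevichZagierPeriods.KontsevichZagierPeriods.Theorems
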